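import Summits.ResolutionOfSingularities.ResolutionOfSingularities.Theorems.FrobeniusLadderFInjectiveMacaulayficationFilteredChartIso
import Summits.ResolutionOfSingularities.ResolutionOfSingularities.Theorems.FrobeniusLadderFInjectiveMacaulayficationFilteredReesInterface
import Summits.ResolutionOfSingularities.ResolutionOfSingularities.Theorems.FrobeniusLadderFInjectiveMacaulayficationFilteredReesChartCore
import Summits.ResolutionOfSingularities.ResolutionOfSingularities.Theorems.FrobeniusLadderFInjectiveMacaulayficationFilteredReesDomain
import Summits.ResolutionOfSingularities.ResolutionOfSingularities.Theorems.FrobeniusLadderFInjectiveMacaulayficationRingVeronese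
import Summits.ResolutionOfSingularities.ResolutionOfSingularities.Theorems.FrobeniusLadderFInjectiveMacaulayficationGradedChartDescent
import HarnessLib

/-!
# G4♮ᵛ — THE FILTERED CHART CLAUSE WITH THE CONE HYPOTHESIS ONLY OFF `V(x̄_v)` (towards the RELATIVE filtered engine)
# (crux `FrobeniusLadder.FInjectiveMacaulayfication` stmt-ResolutionOfSingularities-15315, chain w45a; lead seat res-L1-w45a-lead-1 gen 3)

[OURS · L1 W4.5a] AI-written; AI review is weaker than expert review. NOT a statement of any manuscript; no named fact.

The registered filtered chart clause G4♮ (`FilteredChartClause.stub_filteredChartClause`, p492625) asks the Cohen–Macaulay +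
Frobenius-closed clause of the weighted TANGENT CONE `k[X]/(f₀)` at every maximal ideal missing SOME variable. Reading the landed
chain (stub-2 `ConeFibreClause` p482990 → stub-3 `FilteredReesConeClause` p491511 / `FilteredReesChartCore` p491923 → lead
`FilteredChartClause` p492625) shows the hypothesis is consumed at ONE place, `cone_away_clause_atMaximal`, and only at maximal
ideals missing the CHART variable `x̄_v`. This file re-runs the chain verbatim with that weaker hypothesis
(`hoffv : ∀ Q maximal, x̄_v ∉ Q → clause`): `cone_away_clause_atMaximal_v` → `coneFibreClause_v` → `filteredRees_hclB_v` /
`filteredRees_hclB'_v` → `filteredChartClause_core_v` → **`filteredChartClause_v`** (G4♮ᵛ). Consequence (next file,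
`FilteredConeFiModelRel`): the RELATIVE FILTERED ENGINE — weighted blow-up of an ARBITRARY prime hypersurface along a linear
stratum `V(X_J)` whose weighted tangent cone along the stratum is good off the stratum (hole-#3 producer #3: weighted-equisingular
families `f = f₀(x_J; t) + (higher weight)`, e.g. `z² + x³ + y⁵ + t·x²y²`). No definitions, no named facts. [folklore]
-/

set_option linter.dupNamespace false

noncomputable section

open scoped LaurentPolynomial
open AddMonoidAlgebra LaurentPolynomial AlgebraicGeometry Literature.AlgebraicGeometry.Resolution

namespace Summit.ResolutionOfSingularities.ResolutionOfSingularities.Theorems.FInjectiveMacaulayfication.FilteredChartClauseV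

open Summit.ResolutionOfSingularities.ResolutionOfSingularities.Theorems.FInjectiveMacaulayfication

/-- **The localised cone is good at every closed point — chart-variable form.** As `ConeFibreClause.cone_away_clause_atMaximal`
(stub-2, p482990) but asking the clause of `k[X]/(g)` ONLY at the maximal ideals missing `x̄_v` (the chart variable): the maximal
ideals of `(k[X]/(g))[1/x̄_v^c]` contract to exactly such ideals. Same proof. [folklore] -/
theorem cone_away_clause_atMaximal_v (p : ℕ) [Fact p.Prime] (k : Type) [Field k] [CharP k p] (n : ℕ)
    (g : MvPolynomial (Fin n) k) (v : Fin n) (c : ℕ) (hc : 0 < c)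
    (hoffv : ∀ (Q : Ideal (MvPolynomial (Fin n) k ⧸ Ideal.span {g})) [Q.IsMaximal],
      Ideal.Quotient.mk (Ideal.span {g}) (MvPolynomial.X v) ∉ Q →
      ∀ d : ℕ, ringKrullDim (Localization.AtPrime Q) = d → ∀ t : Fin d → Localization.AtPrime Q,
        (Ideal.span (Set.range t)).radical.IsMaximal →
          RingTheory.Sequence.IsWeaklyRegular (Localization.AtPrime Q) (List.ofFn t) ∧
          ∀ y : Localization.AtPrime Q, (∃ e : ℕ, y ^ p ^ e ∈ Ideal.span
            ((fun z : Localization.AtPrime Q => z ^ p ^ e) ''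
              (Ideal.span (Set.range t) : Set (Localization.AtPrime Q)))) → y ∈ Ideal.span (Set.range t))
    (𝔪 : Ideal (Localization.Away (Ideal.Quotient.mk (Ideal.span {g}) (MvPolynomial.X v) ^ c))) [𝔪.IsMaximal] :
    ∀ d : ℕ, ringKrullDim (Localization.AtPrime 𝔪) = d → ∀ t : Fin d → Localization.AtPrime 𝔪,
      (Ideal.span (Set.range t)).radical.IsMaximal →
        RingTheory.Sequence.IsWeaklyRegular (Localization.AtPrime 𝔪) (List.ofFn t) ∧
        ∀ y : Localization.AtPrime 𝔪, (∃ e : ℕ, y ^ p ^ e ∈ Ideal.span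
          ((fun z : Localization.AtPrime 𝔪 => z ^ p ^ e) ''
            (Ideal.span (Set.range t) : Set (Localization.AtPrime 𝔪)))) → y ∈ Ideal.span (Set.range t) := by
  haveI : IsJacobsonRing (MvPolynomial (Fin n) k ⧸ Ideal.span {g}) :=
    isJacobsonRing_of_finiteType (A := k) (B := MvPolynomial (Fin n) k ⧸ Ideal.span {g})
  -- `P = 𝔪 ∩ k[X]/(g)` is maximal and misses `x̄_v`
  have hP := (IsLocalization.isMaximal_iff_isMaximal_disjoint
    (Localization.Away (Ideal.Quotient.mk (Ideal.span {g}) (MvPolynomial.X v) ^ c))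
    (Ideal.Quotient.mk (Ideal.span {g}) (MvPolynomial.X v) ^ c) 𝔪).mp inferInstance
  haveI : (𝔪.under (MvPolynomial (Fin n) k ⧸ Ideal.span {g})).IsMaximal := hP.1
  have hv : Ideal.Quotient.mk (Ideal.span {g}) (MvPolynomial.X v) ∉ 𝔪.under (MvPolynomial (Fin n) k ⧸ Ideal.span {g}) :=
    fun h => hP.2 (Ideal.pow_mem_of_mem _ h c hc)
  have hcl := hoffv (𝔪.under (MvPolynomial (Fin n) k ⧸ Ideal.span {g})) hv
  -- transport along `(k[X]/(g))_P ≅ F_𝔪`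
  have e : Localization.AtPrime (𝔪.under (MvPolynomial (Fin n) k ⧸ Ideal.span {g})) ≃+* Localization.AtPrime 𝔪 :=
    (IsLocalization.localizationLocalizationAtPrimeIsoLocalization
      (Submonoid.powers (Ideal.Quotient.mk (Ideal.span {g}) (MvPolynomial.X v) ^ c)) 𝔪).toRingEquiv
  refine DegreeZeroDescent.inlineClause_of_ringEquiv p
    (L := Localization.AtPrime (𝔪.under (MvPolynomial (Fin n) k ⧸ Ideal.span {g})))
    (L' := Localization.AtPrime 𝔪) e ?_
  exact hcl

/-- **H-G4a♮ chart-variable form** (`ConeFibreClause.coneFibreClause` with `hoffv`). [cite: Fedder1983, Thm. 3.4 (1)]; folklore. -/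
theorem coneFibreClause_v (p : ℕ) [Fact p.Prime] (k : Type) [Field k] [CharP k p] (n : ℕ)
    (g : MvPolynomial (Fin n) k) (v : Fin n) (c : ℕ) (hc : 0 < c)
    (hoffv : ∀ (Q : Ideal (MvPolynomial (Fin n) k ⧸ Ideal.span {g})) [Q.IsMaximal],
      Ideal.Quotient.mk (Ideal.span {g}) (MvPolynomial.X v) ∉ Q →
      ∀ d : ℕ, ringKrullDim (Localization.AtPrime Q) = d → ∀ t : Fin d → Localization.AtPrime Q,
        (Ideal.span (Set.range t)).radical.IsMaximal →
          RingTheory.Sequence.IsWeaklyRegular (Localization.AtPrime Q) (List.ofFn t) ∧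
          ∀ y : Localization.AtPrime Q, (∃ e : ℕ, y ^ p ^ e ∈ Ideal.span
            ((fun z : Localization.AtPrime Q => z ^ p ^ e) ''
              (Ideal.span (Set.range t) : Set (Localization.AtPrime Q)))) → y ∈ Ideal.span (Set.range t))
    (T : Type) [CommRing T] [IsDomain T] [IsNoetherianRing T] [CharP T p] (s : T) (hs : s ≠ 0)
    (π : T →+* Localization.Away (Ideal.Quotient.mk (Ideal.span {g}) (MvPolynomial.X v) ^ c))
    (hπ : Function.Surjective π) (hker : RingHom.ker π = Ideal.span {s})
    (Q : Ideal T) [Q.IsMaximal] (hsQ : s ∈ Q) :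
    IsDomain (Localization.AtPrime Q) ∧
      ∀ d : ℕ, ringKrullDim (Localization.AtPrime Q) = d → ∀ t : Fin d → Localization.AtPrime Q,
        (Ideal.span (Set.range t)).radical.IsMaximal →
          RingTheory.Sequence.IsWeaklyRegular (Localization.AtPrime Q) (List.ofFn t) ∧
          ∀ y : Localization.AtPrime Q, (∃ e : ℕ, y ^ p ^ e ∈ Ideal.span
            ((fun z : Localization.AtPrime Q => z ^ p ^ e) ''
              (Ideal.span (Set.range t) : Set (Localization.AtPrime Q)))) → y ∈ Ideal.span (Set.range t) :=
  ConeFibreClause.clause_atMaximal_of_fibreSurjection p T s hs _ π hπ hker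
    (fun 𝔪 _ => cone_away_clause_atMaximal_v p k n g v c hc hoffv 𝔪) Q hsQ

/-- **(F4c) chart-variable form** (`FilteredReesConeClause.filteredRees_hclB`, stub-3 p491511, with `hoffv`). [folklore] -/
theorem filteredRees_hclB_v (p : ℕ) [Fact p.Prime] (k : Type) [Field k] [CharP k p] (n : ℕ) (w : Fin n → ℕ) (D : ℕ)
    (f : MvPolynomial (Fin n) k) (fh : MvPolynomial (Option (Fin n)) k)
    (hfh : fh = ∑ b ∈ f.support, MvPolynomial.monomial
      (Finsupp.mapDomain some b + Finsupp.single none (Finsupp.weight w b - D)) (MvPolynomial.coeff b f))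
    (hD0 : ∀ m < D, MvPolynomial.weightedHomogeneousComponent w m f = 0)
    (f₀ : MvPolynomial (Fin n) k) (hf₀ : f₀ = MvPolynomial.weightedHomogeneousComponent w D f) (hD : f₀ ≠ 0)
    (hfprime : (Ideal.span {f}).IsPrime) (hXne : ∀ j : Fin n, Ideal.Quotient.mk (Ideal.span {f}) (MvPolynomial.X j) ≠ 0)
    (v : Fin n) (c : ℕ) (hc : 0 < c)
    (hoffv : ∀ (Q : Ideal (MvPolynomial (Fin n) k ⧸ Ideal.span {f₀})) [Q.IsMaximal],
      Ideal.Quotient.mk (Ideal.span {f₀}) (MvPolynomial.X v) ∉ Q →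
      ∀ d : ℕ, ringKrullDim (Localization.AtPrime Q) = d → ∀ t : Fin d → Localization.AtPrime Q,
        (Ideal.span (Set.range t)).radical.IsMaximal →
          RingTheory.Sequence.IsWeaklyRegular (Localization.AtPrime Q) (List.ofFn t) ∧
          ∀ y : Localization.AtPrime Q, (∃ e : ℕ, y ^ p ^ e ∈ Ideal.span
            ((fun z : Localization.AtPrime Q => z ^ p ^ e) ''
              (Ideal.span (Set.range t) : Set (Localization.AtPrime Q)))) → y ∈ Ideal.span (Set.range t))
    (P : Ideal (Localization.Away (Ideal.Quotient.mk (Ideal.span {fh}) (MvPolynomial.X (some v)) ^ c))) [P.IsMaximal]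
    (hsP : algebraMap (MvPolynomial (Option (Fin n)) k ⧸ Ideal.span {fh}) (Localization.Away (Ideal.Quotient.mk (Ideal.span {fh}) (MvPolynomial.X (some v)) ^ c)) (Ideal.Quotient.mk (Ideal.span {fh}) (MvPolynomial.X none)) ∈ P) :
    IsDomain (Localization.AtPrime P) ∧
      ∀ d : ℕ, ringKrullDim (Localization.AtPrime P) = d → ∀ t : Fin d → Localization.AtPrime P,
        (Ideal.span (Set.range t)).radical.IsMaximal →
          RingTheory.Sequence.IsWeaklyRegular (Localization.AtPrime P) (List.ofFn t) ∧
          ∀ y : Localization.AtPrime P, (∃ e : ℕ, y ^ p ^ e ∈ Ideal.span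
            ((fun z : Localization.AtPrime P => z ^ p ^ e) ''
              (Ideal.span (Set.range t) : Set (Localization.AtPrime P)))) → y ∈ Ideal.span (Set.range t) := by
  have hD' : MvPolynomial.weightedHomogeneousComponent w D f ≠ 0 := hf₀ ▸ hD
  haveI := FilteredReesDomain.isDomain_reesAway w D f fh hfh hD0 hD' hfprime hXne v c
  haveI := FilteredReesDomain.charP_reesAway p w D f fh hfh hD0 hD' hfprime hXne v c
  haveI : IsNoetherianRing (Localization.Away (Ideal.Quotient.mk (Ideal.span {fh}) (MvPolynomial.X (some v)) ^ c)) := Algebra.FiniteType.isNoetherianRing k _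
  obtain ⟨π, -, hπ, hker⟩ := FilteredReesFibre.exists_fibreMap w D f fh hfh hD0 f₀ hf₀ v c
  exact coneFibreClause_v p k n f₀ v c hc hoffv (Localization.Away (Ideal.Quotient.mk (Ideal.span {fh}) (MvPolynomial.X (some v)) ^ c)) _
    (FilteredReesDomain.algebraMap_mk_X_none_ne_zero w D f fh hfh hD0 hD' hfprime hXne v c) π hπ hker P hsP

/-- **(F4c′) chart-variable form** (`FilteredReesConeClause.filteredRees_hclB'` with `hoffv`). [folklore] -/
theorem filteredRees_hclB'_v (p : ℕ) [Fact p.Prime] (k : Type) [Field k] [CharP k p] (n : ℕ) (w : Fin n → ℕ) (D : ℕ)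
    (f : MvPolynomial (Fin n) k) (fh : MvPolynomial (Option (Fin n)) k)
    (hfh : fh = ∑ b ∈ f.support, MvPolynomial.monomial
      (Finsupp.mapDomain some b + Finsupp.single none (Finsupp.weight w b - D)) (MvPolynomial.coeff b f))
    (hD0 : ∀ m < D, MvPolynomial.weightedHomogeneousComponent w m f = 0)
    (f₀ : MvPolynomial (Fin n) k) (hf₀ : f₀ = MvPolynomial.weightedHomogeneousComponent w D f) (hD : f₀ ≠ 0)
    (hfprime : (Ideal.span {f}).IsPrime) (hXne : ∀ j : Fin n, Ideal.Quotient.mk (Ideal.span {f}) (MvPolynomial.X j) ≠ 0)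
    (v : Fin n) (c : ℕ) (hc : 0 < c)
    (hoffv : ∀ (Q : Ideal (MvPolynomial (Fin n) k ⧸ Ideal.span {f₀})) [Q.IsMaximal],
      Ideal.Quotient.mk (Ideal.span {f₀}) (MvPolynomial.X v) ∉ Q →
      ∀ d : ℕ, ringKrullDim (Localization.AtPrime Q) = d → ∀ t : Fin d → Localization.AtPrime Q,
        (Ideal.span (Set.range t)).radical.IsMaximal →
          RingTheory.Sequence.IsWeaklyRegular (Localization.AtPrime Q) (List.ofFn t) ∧
          ∀ y : Localization.AtPrime Q, (∃ e : ℕ, y ^ p ^ e ∈ Ideal.span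
            ((fun z : Localization.AtPrime Q => z ^ p ^ e) ''
              (Ideal.span (Set.range t) : Set (Localization.AtPrime Q)))) → y ∈ Ideal.span (Set.range t)) :
    ∀ (P : Ideal (Localization.Away (Ideal.Quotient.mk (Ideal.span {fh}) (MvPolynomial.X (some v)) ^ c))) [P.IsMaximal],
      algebraMap (MvPolynomial (Option (Fin n)) k ⧸ Ideal.span {fh}) (Localization.Away (Ideal.Quotient.mk (Ideal.span {fh}) (MvPolynomial.X (some v)) ^ c)) (Ideal.Quotient.mk (Ideal.span {fh}) (MvPolynomial.X none)) ∈ P →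
      ∀ d : ℕ, ringKrullDim (Localization.AtPrime P) = d → ∀ t : Fin d → Localization.AtPrime P,
        (Ideal.span (Set.range t)).radical.IsMaximal →
          RingTheory.Sequence.IsWeaklyRegular (Localization.AtPrime P) (List.ofFn t) ∧
          ∀ y : Localization.AtPrime P, (∃ e : ℕ, y ^ p ^ e ∈ Ideal.span
            ((fun z : Localization.AtPrime P => z ^ p ^ e) ''
              (Ideal.span (Set.range t) : Set (Localization.AtPrime P)))) → y ∈ Ideal.span (Set.range t) :=
  fun P _ hsP => (filteredRees_hclB_v p k n w D f fh hfh hD0 f₀ hf₀ hD hfprime hXne v c hc hoffv P hsP).2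

/-- **(F4d) chart-variable form** (`FilteredReesChartCore.filteredChartClause_core`, stub-3 p491923, with `hoffv`). [folklore] -/
theorem filteredChartClause_core_v (p : ℕ) [Fact p.Prime] (k : Type) [Field k] [CharP k p] (n : ℕ) (w : Fin n → ℕ) (D : ℕ)
    (f : MvPolynomial (Fin n) k) (fh : MvPolynomial (Option (Fin n)) k)
    (hfh : fh = ∑ b ∈ f.support, MvPolynomial.monomial
      (Finsupp.mapDomain some b + Finsupp.single none (Finsupp.weight w b - D)) (MvPolynomial.coeff b f))
    (hD0 : ∀ m < D, MvPolynomial.weightedHomogeneousComponent w m f = 0)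
    (f₀ : MvPolynomial (Fin n) k) (hf₀ : f₀ = MvPolynomial.weightedHomogeneousComponent w D f) (hD : f₀ ≠ 0)
    (hfprime : (Ideal.span {f}).IsPrime) (hXne : ∀ j : Fin n, Ideal.Quotient.mk (Ideal.span {f}) (MvPolynomial.X j) ≠ 0)
    (v : Fin n) (c : ℕ) (hc : 0 < c)
    (hoffv : ∀ (Q : Ideal (MvPolynomial (Fin n) k ⧸ Ideal.span {f₀})) [Q.IsMaximal],
      Ideal.Quotient.mk (Ideal.span {f₀}) (MvPolynomial.X v) ∉ Q →
      ∀ d : ℕ, ringKrullDim (Localization.AtPrime Q) = d → ∀ t : Fin d → Localization.AtPrime Q,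
        (Ideal.span (Set.range t)).radical.IsMaximal →
          RingTheory.Sequence.IsWeaklyRegular (Localization.AtPrime Q) (List.ofFn t) ∧
          ∀ y : Localization.AtPrime Q, (∃ e : ℕ, y ^ p ^ e ∈ Ideal.span
            ((fun z : Localization.AtPrime Q => z ^ p ^ e) ''
              (Ideal.span (Set.range t) : Set (Localization.AtPrime Q)))) → y ∈ Ideal.span (Set.range t))
    (A' : Subalgebra k (Localization.Away (Ideal.Quotient.mk (Ideal.span {fh}) (MvPolynomial.X (some v)) ^ c))) [Algebra.IsIntegral A' (Localization.Away (Ideal.Quotient.mk (Ideal.span {fh}) (MvPolynomial.X (some v)) ^ c))] (ρ : (Localization.Away (Ideal.Quotient.mk (Ideal.span {fh}) (MvPolynomial.X (some v)) ^ c)) →ₗ[A'] A') (hρ : ∀ x : A', ρ (x : Localization.Away (Ideal.Quotient.mk (Ideal.span {fh}) (MvPolynomial.X (some v)) ^ c)) = x)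
    (N : ℕ) (hsN : (algebraMap (MvPolynomial (Option (Fin n)) k ⧸ Ideal.span {fh}) (Localization.Away (Ideal.Quotient.mk (Ideal.span {fh}) (MvPolynomial.X (some v)) ^ c)) (Ideal.Quotient.mk (Ideal.span {fh}) (MvPolynomial.X none))) ^ N ∈ A')
    (C₀ : Type) [CommRing C₀] [IsNoetherianRing C₀] [CharP C₀ p] (T : Type) [CommRing T] (ι' : C₀ ≃+* T)
    (e : Localization.Away (Polynomial.X : Polynomial T) ≃+* A') (u₀ : C₀)
    (heN : e.symm ⟨_, hsN⟩ ∈ Ideal.span {algebraMap (Polynomial T) (Localization.Away (Polynomial.X : Polynomial T))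
      (Polynomial.C (ι' u₀))})
    (Q : Ideal C₀) [Q.IsMaximal] (huQ : u₀ ∈ Q) :
    ∀ d : ℕ, ringKrullDim (Localization.AtPrime Q) = d → ∀ t : Fin d → Localization.AtPrime Q,
        (Ideal.span (Set.range t)).radical.IsMaximal →
          RingTheory.Sequence.IsWeaklyRegular (Localization.AtPrime Q) (List.ofFn t) ∧
          ∀ y : Localization.AtPrime Q, (∃ e : ℕ, y ^ p ^ e ∈ Ideal.span
            ((fun z : Localization.AtPrime Q => z ^ p ^ e) ''
              (Ideal.span (Set.range t) : Set (Localization.AtPrime Q)))) → y ∈ Ideal.span (Set.range t) := by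
  have hD' : MvPolynomial.weightedHomogeneousComponent w D f ≠ 0 := hf₀ ▸ hD
  haveI := FilteredReesDomain.isDomain_reesAway w D f fh hfh hD0 hD' hfprime hXne v c
  haveI := FilteredReesDomain.charP_reesAway p w D f fh hfh hD0 hD' hfprime hXne v c
  haveI : IsNoetherianRing T := isNoetherianRing_of_ringEquiv C₀ ι'
  haveI : CharP T p := charP_of_injective_ringHom (f := ι'.toRingHom) ι'.injective p
  exact GradedChartClauseAssembly.chartClause_core_affine p k (Localization.Away (Ideal.Quotient.mk (Ideal.span {fh}) (MvPolynomial.X (some v)) ^ c)) A' ρ hρ _ N hsN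
    (filteredRees_hclB'_v p k n w D f fh hfh hD0 f₀ hf₀ hD hfprime hXne v c hc hoffv) C₀ T ι' e u₀ heN Q huQ

set_option maxHeartbeats 800000 in
/-- **G4♮ᵛ THE FILTERED CHART CLAUSE, chart-variable form**: the registered G4♮ `FilteredChartClause.stub_filteredChartClause`
(lead, p492625) with its tangent-cone hypothesis weakened to the maximal ideals of `k[X]/(f₀)` missing the CHART variable `x̄_v`.
Audit of p492625's chain: `hoff₀` is consumed only by `cone_away_clause_atMaximal`, at contractions of maximal ideals of
`(k[X]/(f₀))[1/x̄_v^c]`, which miss `x̄_v`. Same proof text (800k heartbeats inherited). [folklore] -/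
theorem filteredChartClause_v : ∀ (p : ℕ) [Fact p.Prime] (k : Type) [Field k] [CharP k p] (n : ℕ) (w : Fin n → ℕ) (v : Fin n),
    0 < w v → ∀ (N c D : ℕ), c * w v = N → 0 < c →
    (∀ (K : ℕ) (b : Fin n →₀ ℕ), K * N ≤ Finsupp.weight w b → (MvPolynomial.monomial b (1 : k) : MvPolynomial (Fin n) k) ∈
      (Ideal.span {m : MvPolynomial (Fin n) k | ∃ b : Fin n →₀ ℕ, N ≤ Finsupp.weight w b ∧ m = MvPolynomial.monomial b 1}) ^ K) →
    ∀ (f f₀ : MvPolynomial (Fin n) k), f₀ = MvPolynomial.weightedHomogeneousComponent w D f →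
    (∀ m < D, MvPolynomial.weightedHomogeneousComponent w m f = 0) → f₀ ≠ 0 → (Ideal.span {f}).IsPrime →
    (∀ j : Fin n, Ideal.Quotient.mk (Ideal.span {f}) (MvPolynomial.X j) ≠ 0) →
    (∀ (Q : Ideal (MvPolynomial (Fin n) k ⧸ Ideal.span {f₀})) [Q.IsMaximal],
      Ideal.Quotient.mk (Ideal.span {f₀}) (MvPolynomial.X v) ∉ Q →
      ∀ d : ℕ, ringKrullDim (Localization.AtPrime Q) = d → ∀ s : Fin d → Localization.AtPrime Q,
        (Ideal.span (Set.range s)).radical.IsMaximal →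
          RingTheory.Sequence.IsWeaklyRegular (Localization.AtPrime Q) (List.ofFn s) ∧
          ∀ y : Localization.AtPrime Q, (∃ e : ℕ, y ^ p ^ e ∈ Ideal.span
            ((fun z : Localization.AtPrime Q => z ^ p ^ e) ''
              (Ideal.span (Set.range s) : Set (Localization.AtPrime Q)))) → y ∈ Ideal.span (Set.range s)) →
    ∀ (Q : Ideal (blowupAlgebra ((Ideal.span {m : MvPolynomial (Fin n) k | ∃ b : Fin n →₀ ℕ, N ≤ Finsupp.weight w b ∧
        m = MvPolynomial.monomial b 1}).map (Ideal.Quotient.mk (Ideal.span {f}))) (Ideal.Quotient.mk (Ideal.span {f}) (MvPolynomial.X v) ^ c)))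
      [Q.IsMaximal],
      algebraMap (MvPolynomial (Fin n) k ⧸ Ideal.span {f}) (blowupAlgebra ((Ideal.span {m : MvPolynomial (Fin n) k | ∃ b : Fin n →₀ ℕ,
        N ≤ Finsupp.weight w b ∧ m = MvPolynomial.monomial b 1}).map (Ideal.Quotient.mk (Ideal.span {f})))
          (Ideal.Quotient.mk (Ideal.span {f}) (MvPolynomial.X v) ^ c)) (Ideal.Quotient.mk (Ideal.span {f}) (MvPolynomial.X v) ^ c) ∈ Q →
      ∀ d : ℕ, ringKrullDim (Localization.AtPrime Q) = d → ∀ s : Fin d → Localization.AtPrime Q,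
        (Ideal.span (Set.range s)).radical.IsMaximal →
          RingTheory.Sequence.IsWeaklyRegular (Localization.AtPrime Q) (List.ofFn s) ∧
          ∀ y : Localization.AtPrime Q, (∃ e : ℕ, y ^ p ^ e ∈ Ideal.span
            ((fun z : Localization.AtPrime Q => z ^ p ^ e) ''
              (Ideal.span (Set.range s) : Set (Localization.AtPrime Q)))) → y ∈ Ideal.span (Set.range s) := by
  intro p _ k _ _ n w v hw N c D hcN hc hpow f f₀ hf₀ hD0 hD hfprime hXne hoffv Q _ huQ
  classical
  haveI := hfprime
  haveI : IsDomain (MvPolynomial (Fin n) k ⧸ Ideal.span {f}) := Ideal.Quotient.isDomain _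
  have hN : 0 < N := hcN ▸ Nat.mul_pos hc hw
  -- the carrier `f^h`
  obtain ⟨fh, hfh⟩ : ∃ fh : MvPolynomial (Option (Fin n)) k, fh = ∑ b ∈ f.support, MvPolynomial.monomial
      (Finsupp.mapDomain some b + Finsupp.single none (Finsupp.weight w b - D)) (MvPolynomial.coeff b f) := ⟨_, rfl⟩
  have hf0 : MvPolynomial.weightedHomogeneousComponent w D f ≠ 0 := hf₀ ▸ hD
  haveI hfhprime : (Ideal.span {fh}).IsPrime := by
    haveI := FilteredReesDomain.isDomain_rees w D f fh hfh hD0 hf0 hfprime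
    exact (Ideal.Quotient.isDomain_iff_prime _).mp inferInstance
  -- the coaction on `T′♮`
  obtain ⟨β, hβX, hβk, hβhom, -, -⟩ := WeightCoactionZ.exists_weightCoactionZ
    (fun o : Option (Fin n) => o.elim (-1 : ℤ) (fun j => (w j : ℤ))) fh (D : ℤ)
    (FilteredReesCarrier.fh_isWeightedHomogeneous w D f fh hfh hD0) (MvPolynomial.X (some v) ^ c) (N : ℤ) (by
      have h1 := (MvPolynomial.isWeightedHomogeneous_X k (fun o : Option (Fin n) => o.elim (-1 : ℤ) (fun j => (w j : ℤ)))
        (some v)).pow c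
      rwa [Option.elim_some, nsmul_eq_mul, ← Nat.cast_mul, hcN] at h1)
    (Ideal.Quotient.mk (Ideal.span {fh}) (MvPolynomial.X (some v)) ^ c) (map_pow _ _ _)
  -- the characterising identity in `aeval` form
  have hlam : ∀ a : MvPolynomial (Option (Fin n)) k,
      β (algebraMap (MvPolynomial (Option (Fin n)) k ⧸ Ideal.span {fh}) _ (Ideal.Quotient.mk (Ideal.span {fh}) a)) =
        MvPolynomial.aeval (fun o : Option (Fin n) => single (o.elim (-1 : ℤ) (fun j => (w j : ℤ)))
          (algebraMap (MvPolynomial (Option (Fin n)) k ⧸ Ideal.span {fh})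
            (Localization.Away (Ideal.Quotient.mk (Ideal.span {fh}) (MvPolynomial.X (some v)) ^ c))
            (Ideal.Quotient.mk (Ideal.span {fh}) (MvPolynomial.X o)))) a := by
    intro a
    have h : (β.comp (algebraMap (MvPolynomial (Option (Fin n)) k ⧸ Ideal.span {fh}) _)).comp (Ideal.Quotient.mk (Ideal.span {fh})) =
        (MvPolynomial.aeval (fun o : Option (Fin n) => single (o.elim (-1 : ℤ) (fun j => (w j : ℤ)))
          (algebraMap (MvPolynomial (Option (Fin n)) k ⧸ Ideal.span {fh})
            (Localization.Away (Ideal.Quotient.mk (Ideal.span {fh}) (MvPolynomial.X (some v)) ^ c))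
            (Ideal.Quotient.mk (Ideal.span {fh}) (MvPolynomial.X o))))).toRingHom := by
      refine MvPolynomial.ringHom_ext (fun r => ?_) (fun o => ?_)
      · rw [RingHom.comp_apply, RingHom.comp_apply, AlgHom.toRingHom_eq_coe, RingHom.coe_coe, MvPolynomial.aeval_C,
          ← MvPolynomial.algebraMap_eq, Ideal.Quotient.mk_algebraMap, ← IsScalarTower.algebraMap_apply, hβk,
          LaurentPolynomial.algebraMap_apply, ← single_eq_C]
      · rw [RingHom.comp_apply, RingHom.comp_apply, AlgHom.toRingHom_eq_coe, RingHom.coe_coe, MvPolynomial.aeval_X, hβX]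
    exact RingHom.congr_fun h a
  -- the degree-0 subalgebra and the filtered chart iso
  obtain ⟨T₀, hT₀⟩ := RingVeronese.exists_degSubalgebra (k := k) β (fun r => by rw [hβk, ← single_eq_C])
  have hι' := FilteredChartIso.exists_filteredChartIso w f D fh hfh hD0 hf0 hfprime hfhprime v (hXne v) N c hcN hpow β hβhom T₀ hT₀
  obtain ⟨ι, hιu⟩ := hι'
  -- instances on the chart
  haveI : Algebra.FiniteType (MvPolynomial (Fin n) k ⧸ Ideal.span {f}) (blowupAlgebra ((Ideal.span {m : MvPolynomial (Fin n) k |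
      ∃ b : Fin n →₀ ℕ, N ≤ Finsupp.weight w b ∧ m = MvPolynomial.monomial b 1}).map (Ideal.Quotient.mk (Ideal.span {f})))
      (Ideal.Quotient.mk (Ideal.span {f}) (MvPolynomial.X v) ^ c)) :=
    GradedChartDescent.finiteType_blowupAlgebra _ (IsNoetherian.noetherian _) _
  haveI : IsNoetherianRing (blowupAlgebra ((Ideal.span {m : MvPolynomial (Fin n) k |
      ∃ b : Fin n →₀ ℕ, N ≤ Finsupp.weight w b ∧ m = MvPolynomial.monomial b 1}).map (Ideal.Quotient.mk (Ideal.span {f})))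
      (Ideal.Quotient.mk (Ideal.span {f}) (MvPolynomial.X v) ^ c)) :=
    Algebra.FiniteType.isNoetherianRing (MvPolynomial (Fin n) k ⧸ Ideal.span {f}) _
  haveI : IsDomain (Localization.Away (Ideal.Quotient.mk (Ideal.span {f}) (MvPolynomial.X v) ^ c)) :=
    IsLocalization.isDomain_localization (powers_le_nonZeroDivisors_of_noZeroDivisors (pow_ne_zero c (hXne v)))
  haveI : CharP (blowupAlgebra ((Ideal.span {m : MvPolynomial (Fin n) k |
      ∃ b : Fin n →₀ ℕ, N ≤ Finsupp.weight w b ∧ m = MvPolynomial.monomial b 1}).map (Ideal.Quotient.mk (Ideal.span {f})))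
      (Ideal.Quotient.mk (Ideal.span {f}) (MvPolynomial.X v) ^ c)) p :=
    charP_of_injective_algebraMap (algebraMap k _).injective p
  -- the Rees–Veronese interface, then the chart core
  exact FilteredReesInterface.filteredReesInterface n w v hw N c D hcN hc f fh hfh hD0 β hlam T₀ hT₀ ι _ hιu _
    (fun A' _ ρ hρ hsN T _ ι' e heN => filteredChartClause_core_v p k n w D f fh hfh hD0 f₀ hf₀ hD hfprime
      hXne v c hc hoffv A' ρ hρ N hsN _ T ι' e _ heN Q huQ)

end Summit.ResolutionOfSingularities.ResolutionOfSingularities.Theorems.FInjectiveMacaulayfication.FilteredChartClauseV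

end
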